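import Literature.Barriers.NavierStokesRegularity.NavierStokesInequalitySingularSolutionHolds
import Literature.Barriers.NavierStokesRegularity.SchefferSwitchedScaleInvariance
import Literature.Analysis.FluidPDE.ClassicalNSIRescale
import Literature.Analysis.FluidPDE.NSViscosityRescaling
import HarnessLib

/-!
# Scheffer's singular NSI solution at EVERY viscosity (barrier audit, D-0021)

Barrier-catalogue support file for `NavierStokesRegularity`, outcome of the 2026-08-16 (gen 2)
audit of `NavierStokesInequalitySwitching` (facts A `NSISwitching`, B `NSIBlockExists`) and of the
barrier they assemble, `NavierStokesInequalitySingularSolution`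
(`NavierStokesInequalitySingularSolutions`; Scheffer 1985, Thm. 1.1 = Ożański 2020, Thm. 1.5).

**Audit findings (gen 2).** (1) CONFIRMED at kernel level: `NSISwitching`, `NSIBlockExists`,
`NavierStokesInequalitySingularSolution` and `NavierStokesInequalityNearlyOneDimSingularSet` are
theorems of the tree (`nsiSwitching_holds`, `NSIBlockExists_holds`,
`NavierStokesInequalitySingularSolution_holds`, `NavierStokesInequalityNearlyOneDimSingularSet_holds`;
axiom closure re-checked: `propext`, `Classical.choice`, `Quot.sound`). (2) The rendering
`IsNSIBlock` is the printed list of hypotheses word for word (Ożański 2017, §2, p. 6: `T > 0`,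
compact `G`, `u ∈ C^∞(ℝ³ × (-η, T+η))`, `supp u(t) = G` on `[0,T]`, the pointwise NSI (2.1) for
all `ν ∈ [0, ν₀]`, `Γ(G) ⊆ G`, the gain (2.2); plus Scheffer's `f₁ ≠ 0`, Lemma 2.3, p. 55).
(3) Literature since 2020 is consistent with the barrier and makes its upper side a printed
theorem in the NSI class: `𝒫¹(S) = 0` for weak NSI solutions (G. Koch, Anal. PDE 16 (2023),
abstract and §1, "we verify Scheffer's assertion that the same hold for solutions of the weaker
inequality"), and even the parabolic box-counting bound `dim_pf(Σ₋ ∩ K) ≤ 95/63` for the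
forward-singular set (G. Koch, DCDS 2023, Thm. 2 with `d ≡ 0`); Scheffer's Cantor examples
(Thm. 1.6: for every `ξ < 1` a forward-singular set `S' × {T₀}` with `dim_pf = d_H ∈ [ξ, 1)`)
close every Hausdorff-dimension improvement inside the NSI class and leave open there only where
in `[1, 95/63]` the supremum of the box-counting dimensions lies.
(4) SHARPENED here, with proof: the printed viscosities are `ν ∈ [0, ν₀]` with `ν₀` small
(`scope_caveats` (ii) of the parent entry; Ożański 2017, p. 4: "It is clear, using an appropriate
rescaling, that the statement of the above theorem is equivalent to the one where `ν = 1`").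
The amplitude–time rescaling `u ↦ a u(a t, x)` (`Fluid.timeRescale a a`, amplitude `a`, time
dilation `a`, no space dilation) multiplies the inviscid terms of the pointwise NSI by `a³` and
the viscous one by `a²`, so it maps classical NSI blocks with maximal viscosity `ν₀` to blocks with
maximal viscosity `a ν₀` (`IsNSIBlock.viscosityRescale`); hence a block, and by the proved
switching principle a singular weak NSI solution, exists for EVERY prescribed viscosity `ν > 0`
(`exists_isNSIBlock_viscosity`, `navierStokesInequalitySingularSolution_viscosity`,
`exists_nonempty_singularSet_viscosity`), together with the sharpened conclusions of
`NavierStokesInequalitySingularSolutionsNarrow` (Type I in time and space, bounded `L³`, energy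
jump) and their two negative corollaries, all at the prescribed viscosity
(`navierStokesInequalitySingularSolutionNarrow_viscosity`, `not_nsi_typeI_exclusion_viscosity`,
`not_nsi_L3_criterion_viscosity`): the barrier applies verbatim at the summit's own `ν`.
No facts or definitions are introduced.

**Not covered by the theorem (recorded for planners; see also `…SingularSolutionsNarrow`,
`scope_caveats` (vi)).** Every singular NSI field in print is NON-axisymmetric: the block
`u[v,f]` is axisymmetric with swirl about an axis its support avoids (Ożański 2017, §3.3:
"supp u[v,f] is strictly separated from the Ox₁ axis"; Scheffer 1985, p. 51: "w equals 0 in a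
neighborhood of the x₁ axis"), the similarity centre `x₀ = z/(1-τ) ∈ ⋂ Γ^j(G) ⊆ R(Ū₂)` lies off
that axis (Ożański 2017, §4 (4.3) and end of §5.4: `Γ(G) ⊂ R(Ū₂) ⊂ G`; Scheffer 1985,
Lemma 2.4: `a = (a₁, a₂, 0)`), so consecutive pieces are symmetric about distinct parallel axes. Since
`𝒫¹(S) = 0` holds in the NSI class, an axisymmetric weak NSI solution can be singular only on
its axis, which supports of structures never reach; the switching theorem `nsiSwitching_holds`
would turn any on-axis self-replicating block into an axisymmetric singular NSI solution, but no
such block is constructed in print (searched 2026-08-16: Scheffer 1985/1987, Ożański 2017, 2019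
book, 2020; Koch 2023a,b). Arguments confined to axisymmetric data are therefore outside the
certified reach of this barrier — an open construction problem, not an asserted gap.

**Also open (time regularity; `evasions_known` (b) of `…SingularSolutionsNarrow`).** Every
printed singular NSI field switches, hence jumps in `L²`. A smooth finite-energy divergence-free
profile `U ≢ 0` on `ℝ³` with `U·(½U + ½ y·∇U + (U·∇)U + ∇p̃[U] - νΔU) ≤ 0` pointwise would give
the Leray-self-similar field `(T*-t)^{-1/2} U(x/√(T*-t))`, a weak NSI solution (energy
`(T*-t)^{1/2}‖U‖²₂ → 0`, extended by `0`) that is smooth and time-continuous on `[0,T*)` and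
singular at `(T*, 0)`; neither such a profile nor an NSI-valid Liouville theorem excluding it is
in print — the Nečas–Růžička–Šverák (1996) and Tsai (1998) exclusions of Leray's self-similar
blow-up rest on the elliptic equation for `|U|²/2 + P + ½ y·U`, i.e. on the Navier–Stokes
equations themselves. (Necessary conditions: `ν‖∇U‖²₂ ≤ ¼‖U‖²₂`; at a maximum point `y*` of
`|U|`, `U·∇p̃[U](y*) ≤ -½|U(y*)|²`.)

## References

* V. Scheffer, Comm. Math. Phys. 101 (1985), 47–85: Thm. 1.1, Lemmas 2.3–2.4, p. 51.
  [`Scheffer1985`]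
* W. S. Ożański, arXiv:1709.00602 (2017): Thm. 1 and the rescaling remark (p. 4), §2 (p. 6),
  §3.3, §4 (4.3), §5.4. [`Ozanski2017NSISingular`]
* W. S. Ożański, Comm. Math. Phys. 374 (2020), Thm. 1.5 and the paragraph after it.
  [`Ozanski2019NSI`]
* G. S. Koch, *Partial regularity for Navier–Stokes and liquid crystals inequalities without
  maximum principle*, Anal. PDE 16 (2023), 1701–1744 = arXiv:2001.04098, abstract, §1. [`Koch2020`]
* G. S. Koch, *Parabolic fractal dimension of forward-singularities for Navier–Stokes and liquid
  crystals inequalities*, DCDS (2023) = arXiv:2204.08370, Thms. 2–3. [`Koch2022`]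
-/

noncomputable section

open MeasureTheory Set Function Filter Topology TopologicalSpace InnerProductSpace
open scoped InnerProductSpace RealInnerProductSpace ContDiff Laplacian ENNReal

namespace Literature.Barriers.NavierStokesRegularity

open Literature.Analysis.FluidPDE

/-- Local notation for physical space `ℝ³ = EuclideanSpace ℝ (Fin 3)`. -/
local notation "ℝ³" => EuclideanSpace ℝ (Fin 3)

/-! ### Viscosity covariance of the pointwise Navier–Stokes inequality -/

section Pointwise

variable {E : Type*} [NormedAddCommGroup E] [InnerProductSpace ℝ E] [FiniteDimensional ℝ E]
  [MeasurableSpace E] [BorelSpace E]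

/-- **The amplitude–time rescaling `w(t, x) = a u(t₀ + a t, x₀ + x)` maps the pointwise
Navier–Stokes inequality with viscosity `ν` to the one with viscosity `a ν`** (`a > 0`; pressure
functions = normalised pressures of the slices): the time-derivative and transport/pressure terms
are multiplied by `a³`, the viscous term by `a²` (Ożański 2017, p. 4: "using an appropriate
rescaling … the statement … is equivalent to the one where `ν = 1`"; here the rescaling without
space dilation, which keeps the support). [cite: Ozanski2017NSISingular, Thm. 1 and p. 4] -/
theorem nsi_viscosity_smul_stPull {u : ℝ → E → E} {a t₀ ν t : ℝ} {x₀ x : E} (ha : 0 < a)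
    (hu2 : ContDiff ℝ 2 (u (t₀ + a * t)))
    (hg : DifferentiableAt ℝ (fun y => ‖u (t₀ + a * t) y‖ ^ 2 +
      2 * normalisedPressure (u (t₀ + a * t)) y) (x₀ + (1 : ℝ) • x))
    (hnsi : timeDeriv (fun s y => ‖u s y‖ ^ 2) (t₀ + a * t) (x₀ + (1 : ℝ) • x) ≤
      -⟪u (t₀ + a * t) (x₀ + (1 : ℝ) • x), gradient (fun y => ‖u (t₀ + a * t) y‖ ^ 2 +
        2 * normalisedPressure (u (t₀ + a * t)) y) (x₀ + (1 : ℝ) • x)⟫ +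
      2 * ν * ⟪u (t₀ + a * t) (x₀ + (1 : ℝ) • x), Δ (u (t₀ + a * t)) (x₀ + (1 : ℝ) • x)⟫) :
    timeDeriv (fun s y => ‖(a • stPull a 1 t₀ x₀ u) s y‖ ^ 2) t x ≤
      -⟪(a • stPull a 1 t₀ x₀ u) t x,
          gradient (fun y => ‖(a • stPull a 1 t₀ x₀ u) t y‖ ^ 2 +
            2 * normalisedPressure ((a • stPull a 1 t₀ x₀ u) t) y) x⟫ +
      2 * (a * ν) * ⟪(a • stPull a 1 t₀ x₀ u) t x, Δ ((a • stPull a 1 t₀ x₀ u) t) x⟫ := by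
  haveI : CompleteSpace E := FiniteDimensional.complete ℝ E
  set s : ℝ := t₀ + a * t with hs
  set y : E := x₀ + (1 : ℝ) • x with hy
  -- the scalar field `Θ = |u|² + 2p̃[u]` and its pull-back
  set Θ : ℝ → E → ℝ := fun s' y' => ‖u s' y'‖ ^ 2 + 2 * normalisedPressure (u s') y' with hΘ
  have hθw : (fun y' => ‖(a • stPull a 1 t₀ x₀ u) t y'‖ ^ 2 +
      2 * normalisedPressure ((a • stPull a 1 t₀ x₀ u) t) y') =
      fun y' => a ^ 2 • stPull a 1 t₀ x₀ Θ t y' := by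
    funext y'
    rw [normalisedPressure_smul_stPull_slice a a one_pos t₀ x₀ u t]
    simp only [Pi.smul_apply, stPull_apply, norm_smul, mul_pow, Real.norm_eq_abs, sq_abs, hΘ,
      smul_eq_mul]
    ring
  -- (1) the time derivative scales by `a³`
  have h1 : timeDeriv (fun s y => ‖(a • stPull a 1 t₀ x₀ u) s y‖ ^ 2) t x =
      a ^ 3 * timeDeriv (fun t x => ‖u t x‖ ^ 2) s y := by
    rw [timeDeriv_normSq_smul_stPull]
    ring
  -- (2) the transport/pressure term scales by `a³`
  have hΘd : DifferentiableAt ℝ (stPull a 1 t₀ x₀ Θ t) x := by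
    have : stPull a 1 t₀ x₀ Θ t = fun y' => Θ s (x₀ + (1 : ℝ) • y') := rfl
    rw [this]
    exact hg.comp x ((differentiableAt_const _).add (differentiableAt_id.const_smul (1 : ℝ)))
  have h2 : ⟪(a • stPull a 1 t₀ x₀ u) t x,
      gradient (fun y' => ‖(a • stPull a 1 t₀ x₀ u) t y'‖ ^ 2 +
        2 * normalisedPressure ((a • stPull a 1 t₀ x₀ u) t) y') x⟫ =
      a ^ 3 * ⟪u s y, gradient (Θ s) y⟫ := by
    rw [hθw, gradient_const_smul hΘd, gradient_stPull]
    simp only [Pi.smul_apply, stPull_apply, inner_smul_left, inner_smul_right, RCLike.conj_to_real]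
    ring
  -- (3) the viscous term scales by `a²`
  have h3 : ⟪(a • stPull a 1 t₀ x₀ u) t x, Δ ((a • stPull a 1 t₀ x₀ u) t) x⟫ =
      a ^ 2 * ⟪u s y, Δ (u s) y⟫ := by
    rw [laplacian_smul_stPull_slice hu2]
    simp only [Pi.smul_apply, stPull_apply, inner_smul_left, inner_smul_right, RCLike.conj_to_real]
    ring
  rw [h1, h2, h3]
  have ha3 : 0 < a ^ 3 := pow_pos ha 3
  have key := mul_le_mul_of_nonneg_left hnsi ha3.le
  have e : a ^ 3 * (-⟪u s y, gradient (Θ s) y⟫ + 2 * ν * ⟪u s y, Δ (u s) y⟫) =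
      -(a ^ 3 * ⟪u s y, gradient (Θ s) y⟫) + 2 * (a * ν) * (a ^ 2 * ⟪u s y, Δ (u s) y⟫) := by
    ring
  rw [e] at key
  exact key

omit [FiniteDimensional ℝ E] [MeasurableSpace E] [BorelSpace E] in
/-- The two notations for the amplitude–time rescaling agree:
`a • stPull a 1 0 0 u = timeRescale a a u`, i.e. `(t, x) ↦ a u(a t, x)`. [folklore] -/
theorem smul_stPull_one_eq_timeRescale (a : ℝ) (u : ℝ → E → E) :
    a • stPull a 1 0 0 u = timeRescale a a u := by
  funext s y
  simp [stPull_apply, timeRescale_apply]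

end Pointwise

/-- `s ∈ [0, a⁻¹T]` iff-direction used below: then `a s ∈ [0, T]` (`a > 0`). [folklore] -/
theorem mul_mem_Icc_of_mem_Icc_inv_mul {a T s : ℝ} (ha : 0 < a) (hs : s ∈ Icc 0 (a⁻¹ * T)) :
    a * s ∈ Icc 0 T := by
  refine ⟨mul_nonneg ha.le hs.1, ?_⟩
  have := mul_le_mul_of_nonneg_left hs.2 ha.le
  rwa [mul_inv_cancel_left₀ ha.ne'] at this

/-! ### Rescaling a classical block to any maximal viscosity -/

namespace IsNSIBlock

variable {T ν₀ τ : ℝ} {z : ℝ³} {G : Set ℝ³} {u : ℝ → ℝ³ → ℝ³}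

/-- **Viscosity rescaling of a classical NSI block.** If `(T, ν₀, τ, z, G, u)` is a classical
block (`IsNSIBlock`), then for every `a > 0` so is `(a⁻¹T, a ν₀, τ, z, G, (t,x) ↦ a u(a t, x))`:
same similarity `Γ`, same support `G`, lifetime `a⁻¹T`, and the pointwise NSI now for all
`ν ∈ [0, a ν₀]` (`nsi_viscosity_smul_stPull`); the gain of magnitude (2.2) and `u(·,0) ≢ 0` are
homogeneous. This is the rescaling behind "the statement of [Thm. 1] is equivalent to the one
where `ν = 1`" (Ożański 2017, p. 4), in the form that keeps the support fixed.
[cite: Ozanski2017NSISingular, Thm. 1 and p. 4; §2 (2.1)–(2.2)] -/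
theorem viscosityRescale (h : IsNSIBlock T ν₀ τ z G u) {a : ℝ} (ha : 0 < a) :
    IsNSIBlock (a⁻¹ * T) (a * ν₀) τ z G (timeRescale a a u) where
  T_pos := mul_pos (inv_pos.2 ha) h.T_pos
  ν₀_pos := mul_pos ha h.ν₀_pos
  τ_pos := h.τ_pos
  τ_lt_one := h.τ_lt_one
  isCompact := h.isCompact
  smooth := by
    obtain ⟨η, hη, hs⟩ := h.smooth
    refine ⟨a⁻¹ * η, mul_pos (inv_pos.2 ha) hη, hs.timeRescale a a ?_⟩
    intro s hs'
    simp only [mem_Ioo] at hs' ⊢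
    constructor
    · have h1 := mul_lt_mul_of_pos_left hs'.1 ha
      have e : a * -(a⁻¹ * η) = -η := by
        rw [mul_neg, mul_inv_cancel_left₀ ha.ne']
      rwa [e] at h1
    · have h2 := mul_lt_mul_of_pos_left hs'.2 ha
      have e : a * (a⁻¹ * T + a⁻¹ * η) = T + η := by
        rw [mul_add, mul_inv_cancel_left₀ ha.ne', mul_inv_cancel_left₀ ha.ne']
      rwa [e] at h2
  divFree := by
    intro s hs
    have hσ : a * s ∈ Icc 0 T := mul_mem_Icc_of_mem_Icc_inv_mul ha hs
    have hu1 : ContDiff ℝ 1 (u (a * s)) := (h.contDiff_slice hσ).of_le (by norm_cast)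
    rw [timeRescale_slice]
    exact (h.divFree _ hσ).const_smul (hu1.differentiable (by simp)) a
  tsupport_eq := by
    intro s hs
    have hσ : a * s ∈ Icc 0 T := mul_mem_Icc_of_mem_Icc_inv_mul ha hs
    have e : tsupport (timeRescale a a u s) = tsupport (u (a * s)) :=
      congrArg closure (Function.support_const_smul_of_ne_zero a (u (a * s)) ha.ne')
    rw [e]
    exact h.tsupport_eq _ hσ
  nsi := by
    intro ν hν s hs x
    have hσ : a * s ∈ Icc 0 T := mul_mem_Icc_of_mem_Icc_inv_mul ha hs
    have hσ' : 0 + a * s ∈ Icc 0 T := by simpa using hσ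
    have hν' : a⁻¹ * ν ∈ Icc 0 ν₀ := by
      refine ⟨mul_nonneg (inv_nonneg.2 ha.le) hν.1, ?_⟩
      have := mul_le_mul_of_nonneg_left hν.2 (inv_nonneg.2 ha.le)
      rwa [inv_mul_cancel_left₀ ha.ne'] at this
    have hblock := h.nsi (a⁻¹ * ν) hν' (0 + a * s) hσ' (0 + (1 : ℝ) • x)
    have huσ : ContDiff ℝ ∞ (u (0 + a * s)) := h.contDiff_slice hσ'
    have hu2 : ContDiff ℝ 2 (u (0 + a * s)) := huσ.of_le (by norm_cast)
    have huc : HasCompactSupport (u (0 + a * s)) := h.hasCompactSupport_slice hσ'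
    have hp2 : ContDiff ℝ 2 (normalisedPressure (u (0 + a * s))) :=
      contDiff_normalisedPressure_of_hasCompactSupport huσ huc
    have hQd : Differentiable ℝ (fun y => ‖u (0 + a * s) y‖ ^ 2 +
        2 * normalisedPressure (u (0 + a * s)) y) :=
      ((hu2.differentiable (by norm_num)).norm_sq ℝ).add
        ((hp2.differentiable (by norm_num)).const_mul 2)
    have key := nsi_viscosity_smul_stPull (t₀ := 0) (x₀ := 0) (t := s) (x := x) ha hu2
      (hQd.differentiableAt) hblock
    rw [smul_stPull_one_eq_timeRescale, mul_inv_cancel_left₀ ha.ne'] at key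
    exact key
  mapsTo := h.mapsTo
  gain := by
    intro x
    have hg := h.gain x
    simp only [timeRescale_apply, mul_zero, norm_smul, Real.norm_eq_abs, abs_of_pos ha,
      mul_inv_cancel_left₀ ha.ne']
    calc τ⁻¹ * (a * ‖u 0 x‖) = a * (τ⁻¹ * ‖u 0 x‖) := by ring
      _ ≤ a * ‖u T (τ • x + z)‖ := mul_le_mul_of_nonneg_left hg ha.le
  nontrivial := by
    obtain ⟨x, hx⟩ := h.nontrivial
    refine ⟨x, ?_⟩
    rw [timeRescale_apply, mul_zero]
    exact smul_ne_zero ha.ne' hx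

end IsNSIBlock

/-! ### The barrier at every viscosity -/

/-- **A classical NSI block exists for EVERY maximal viscosity `ν > 0`**: rescale the block of
`NSIBlockExists_holds` (Ożański 2017, §4 Prop. 9 with §5; Scheffer 1985, Lemmas 2.4, 3.3, 6.4) by
`IsNSIBlock.viscosityRescale` with `a = ν/ν₀`. [cite: Ozanski2017NSISingular, Thm. 1 and p. 4; §4] -/
theorem exists_isNSIBlock_viscosity {ν : ℝ} (hν : 0 < ν) :
    ∃ (T τ : ℝ) (z : ℝ³) (G : Set ℝ³) (u : ℝ → ℝ³ → ℝ³), IsNSIBlock T ν τ z G u := by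
  obtain ⟨T, ν₀, τ, z, G, u, h⟩ := NSIBlockExists_holds
  have ha : 0 < ν / ν₀ := div_pos hν h.ν₀_pos
  have hb := h.viscosityRescale ha
  rw [div_mul_cancel₀ ν h.ν₀_pos.ne'] at hb
  exact ⟨_, τ, z, G, _, hb⟩

/-- **Scheffer's theorem at every viscosity (Scheffer 1985, Thm. 1.1; Ożański 2020, Thm. 1.5,
with the rescaling remark of Ożański 2017, p. 4).** For EVERY `ν > 0` there are a compact
`K ⊆ ℝ³` and a field `u` with its pressure `p = p̃[u(·)]` such that `(u, p)` is a weak solution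
of the Navier–Stokes inequality on `ℝ³ × (0,∞)` for every viscosity `ν' ∈ [0, ν]` — in
particular for `ν` itself —, every slice `u(t)`, `t ≥ 0`, is `C^∞` with support in `K`, and some
point `(T₀, x₀)`, `T₀ > 0`, is singular (`¬ IsRegularPoint`). This is the parent barrier fact
`NavierStokesInequalitySingularSolution` with its existential `ν₀` replaced by an arbitrary
prescribed viscosity: `scope_caveats` (ii) of that entry ("`ν₀` small") is thereby discharged.
[cite: Scheffer1985, Thm. 1.1] [cite: Ozanski2019NSI, Thm. 1.5]
[cite: Ozanski2017NSISingular, Thm. 1 and p. 4] -/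
theorem navierStokesInequalitySingularSolution_viscosity {ν : ℝ} (hν : 0 < ν) :
    ∃ (K : Set ℝ³) (u : ℝ → ℝ³ → ℝ³) (p : ℝ → ℝ³ → ℝ),
      IsCompact K ∧ (∀ ν' ∈ Icc (0 : ℝ) ν, IsWeakNSISolution ν' u p) ∧
      (∀ t : ℝ, 0 ≤ t → ContDiff ℝ ∞ (u t) ∧ tsupport (u t) ⊆ K) ∧
      ∃ (T₀ : ℝ) (x₀ : ℝ³), 0 < T₀ ∧ ¬ IsRegularPoint u (T₀, x₀) := by
  obtain ⟨T, τ, z, G, u, h⟩ := exists_isNSIBlock_viscosity hν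
  obtain ⟨𝔲, -, -, hsol, hslice, hsing⟩ := nsiSwitching_holds T ν τ z G u h
  exact ⟨G, 𝔲, fun t => normalisedPressure (𝔲 t), h.isCompact, hsol, hslice,
    blowupTime T τ, blowupPoint τ z, h.blowupTime_pos, hsing⟩

/-- **No NSI-valid regularity argument at ANY fixed viscosity**: for every `ν > 0` there is a
weak solution of the Navier–Stokes inequality with viscosity exactly `ν` whose CKN singular set
in positive times `Fluid.singularSet u ↑positiveTimes` is nonempty (cf. the parent corollary
`NavierStokesInequalitySingularSolution.exists_nonempty_singularSet`, which has `∃ ν`).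
[cite: Ozanski2019NSI, Thm. 1.5 and p. 4] [cite: Ozanski2017NSISingular, p. 4] -/
theorem exists_nonempty_singularSet_viscosity {ν : ℝ} (hν : 0 < ν) :
    ∃ (u : ℝ → ℝ³ → ℝ³) (p : ℝ → ℝ³ → ℝ), IsWeakNSISolution ν u p ∧
      (∀ t : ℝ, 0 ≤ t → ContDiff ℝ ∞ (u t) ∧ HasCompactSupport (u t)) ∧
      (singularSet u ((positiveTimes : Opens (ℝ × ℝ³)) : Set (ℝ × ℝ³))).Nonempty := by
  obtain ⟨K, u, p, hK, hsol, hslice, T₀, x₀, hT₀, hsing⟩ :=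
    navierStokesInequalitySingularSolution_viscosity hν
  refine ⟨u, p, hsol ν ⟨hν.le, le_rfl⟩, fun t ht => ⟨(hslice t ht).1,
    hK.of_isClosed_subset (isClosed_tsupport _) (hslice t ht).2⟩, (T₀, x₀), ?_⟩
  rw [mem_singularSet]
  exact ⟨by simp [hT₀], hsing⟩

/-! ### The sharpened conclusions at every viscosity -/

/-- **Scheffer's singular NSI solution at a PRESCRIBED viscosity, with the sharpened conclusions of
`NavierStokesInequalitySingularSolutionNarrow`**: for every `ν > 0` a weak solution of the
Navier–Stokes inequality for all `ν' ∈ [0, ν]`, with `C^∞` slices supported in a fixed compact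
set, singular at a point `(T₀, x₀)`, `T₀ > 0`, which (a) blows up at the Type-I rate in time at
`T₀`, (b) obeys `‖x - x₀‖ ‖u(t,x)‖ ≤ C`, (c) keeps `sup_t ∫|u(t)|³ < ∞`, and (d) has an energy that
is not left-continuous at some `t₁ ∈ (0, T₀)`. PROVED: the switched field of the rescaled block of
`exists_isNSIBlock_viscosity` (Ożański 2017, §2.1, pp. 6–7, for the remarks (a)–(d)).
[cite: Scheffer1985, Thm. 1.1 and Lemma 2.3] [cite: Ozanski2019NSI, Thm. 1.5]
[cite: Ozanski2017NSISingular, §2.1 (pp. 6–7) and p. 4] -/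
theorem navierStokesInequalitySingularSolutionNarrow_viscosity {ν : ℝ} (hν : 0 < ν) :
    ∃ (K : Set ℝ³) (u : ℝ → ℝ³ → ℝ³) (p : ℝ → ℝ³ → ℝ),
      IsCompact K ∧ (∀ ν' ∈ Icc (0 : ℝ) ν, IsWeakNSISolution ν' u p) ∧
      (∀ t : ℝ, 0 ≤ t → ContDiff ℝ ∞ (u t) ∧ tsupport (u t) ⊆ K) ∧
      ∃ (T₀ : ℝ) (x₀ : ℝ³), 0 < T₀ ∧ ¬ IsRegularPoint u (T₀, x₀) ∧
        IsTypeIBlowup u T₀ ∧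
        (∃ C : ℝ, ∀ (t : ℝ) (x : ℝ³), ‖x - x₀‖ * ‖u t x‖ ≤ C) ∧
        (∃ C : ℝ≥0∞, C < ⊤ ∧ ∀ t : ℝ, ∫⁻ x, ‖u t x‖ₑ ^ 3 ≤ C) ∧
        ∃ t₁ ∈ Ioo (0 : ℝ) T₀,
          ¬ ContinuousWithinAt (fun t => ∫⁻ x, ‖u t x‖ₑ ^ 2) (Iio t₁) t₁ := by
  obtain ⟨T, τ, z, G, u, h⟩ := exists_isNSIBlock_viscosity hν
  obtain ⟨C₁, -, hC₁⟩ := h.norm_glue_le_div_sqrt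
  obtain ⟨C₂, -, hC₂⟩ := h.norm_sub_mul_norm_glue_le
  refine ⟨G, Scheffer.glue T τ z u, fun s => normalisedPressure (Scheffer.glue T τ z u s),
    h.isCompact, fun ν' hν' => h.isWeakNSISolution_glue hν',
    fun t _ => ⟨h.contDiff_glue_slice t, h.tsupport_glue_slice_subset t⟩,
    blowupTime T τ, blowupPoint τ z, h.blowupTime_pos, h.not_isRegularPoint_glue,
    ⟨C₁, eventually_nhdsWithin_of_forall fun t ht => hC₁ t ht⟩, ⟨C₂, hC₂⟩,
    h.lintegral_norm_glue_cube_le, T, ⟨h.T_pos, h.lt_blowupTime⟩,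
    h.not_continuousWithinAt_energy_glue⟩

/-- **No NSI-valid Type-I exclusion at ANY viscosity**: for every `ν > 0` it is FALSE that every
weak solution of the Navier–Stokes inequality with viscosity `ν`, with `C^∞` compactly supported
slices, blowing up at most at the Type-I rate at a time `T > 0`, is regular at all points
`(T, x)` (the `∃ ν` form is `not_nsi_typeI_exclusion` of `…SingularSolutionsNarrow`).
[cite: Ozanski2017NSISingular, §2.1 (p. 6) and p. 4] -/
theorem not_nsi_typeI_exclusion_viscosity {ν : ℝ} (hν : 0 < ν) :
    ¬ (∀ (T : ℝ) (u : ℝ → ℝ³ → ℝ³) (p : ℝ → ℝ³ → ℝ), 0 < T →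
        IsWeakNSISolution ν u p →
        (∀ t : ℝ, 0 ≤ t → ContDiff ℝ ∞ (u t) ∧ HasCompactSupport (u t)) →
        IsTypeIBlowup u T → ∀ x : ℝ³, IsRegularPoint u (T, x)) := by
  intro hN
  obtain ⟨K, u, p, hK, hsol, hslice, T₀, x₀, hT₀, hsing, htypeI, -⟩ :=
    navierStokesInequalitySingularSolutionNarrow_viscosity hν
  refine hsing (hN T₀ u p hT₀ (hsol ν ⟨hν.le, le_rfl⟩) (fun t ht => ?_) htypeI x₀)
  exact ⟨(hslice t ht).1, hK.of_isClosed_subset (isClosed_tsupport _) (hslice t ht).2⟩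

/-- **No NSI-valid bounded-`L³` criterion at ANY viscosity**: for every `ν > 0` it is FALSE that
every weak solution of the Navier–Stokes inequality with viscosity `ν`, with `C^∞` compactly
supported slices and `sup_t ∫|u(t)|³ < ∞`, is regular at all points of positive time (the `∃ ν`
form is `not_nsi_L3_criterion`; "the `L_{3,∞}` regularity criterion uses, in an essential way,
properties of solutions of the Navier–Stokes equations").
[cite: Ozanski2017NSISingular, §2.1 (p. 7) and p. 4] -/
theorem not_nsi_L3_criterion_viscosity {ν : ℝ} (hν : 0 < ν) :
    ¬ (∀ (u : ℝ → ℝ³ → ℝ³) (p : ℝ → ℝ³ → ℝ),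
        IsWeakNSISolution ν u p →
        (∀ t : ℝ, 0 ≤ t → ContDiff ℝ ∞ (u t) ∧ HasCompactSupport (u t)) →
        (∃ C : ℝ≥0∞, C < ⊤ ∧ ∀ t : ℝ, ∫⁻ x, ‖u t x‖ₑ ^ 3 ≤ C) →
        ∀ (T : ℝ) (x : ℝ³), 0 < T → IsRegularPoint u (T, x)) := by
  intro hN
  obtain ⟨K, u, p, hK, hsol, hslice, T₀, x₀, hT₀, hsing, -, -, hL3, -⟩ :=
    navierStokesInequalitySingularSolutionNarrow_viscosity hν
  refine hsing (hN u p (hsol ν ⟨hν.le, le_rfl⟩) (fun t ht => ?_) hL3 T₀ x₀ hT₀)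
  exact ⟨(hslice t ht).1, hK.of_isClosed_subset (isClosed_tsupport _) (hslice t ht).2⟩

end Literature.Barriers.NavierStokesRegularity

end
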